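import Summits.HodgeConjecture.HodgeConjecture.Theorems.K2E3OrbitClosureSemisimpleEngine   -- ★ p855578 (this seat): `exists_cocharacter_conj_tendsto`, `semisimplePart_mem_closure_conjClass`
import HarnessLib

/-!
# K2 ∕ E3 «EllipticInputs», unit U12 — GENERIC ENGINE of socket U12-b, file 1b `K2E3OrbitClosureSemisimpleEngineGL`:
# **the same statement in the topology of `GL_n(F)`** (units topology: values AND inverses converge) and inside any subgroup `Γ ≤ GL_n(F)` with the subspace topology

Cell `hodgecm-mathlib` (Track B «K2-LIT»), engine E3, crux H413 = `stmt-HodgeConjecture-24833`; socket `U12Characters.sig_K2E3OrbitClosureContainsSemisimple` takes its `closure` in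
`(UnitaryGroup.cmDatum L N H).Local v = ↥(UnitaryGroup.«local» …) ≤ GL_N(Π_{w∣v} L_w)`, i.e. in the SUBSPACE topology of the UNITS topology of `GL_N` (Mathlib `Units.instTopologicalSpaceUnits`,
induced by `x ↦ (x, x⁻¹)`), not in `M_N`.  This file upgrades ★ file 1 (`K2E3OrbitClosureSemisimpleEngine`, matrix topology) accordingly: over a topological field with CONTINUOUS
INVERSION (`ContinuousInv₀`, every non-archimedean local field) matrix convergence of invertible matrices to an invertible limit entails convergence of the inverses (`A⁻¹ = (det A)⁻¹·adj A`),
hence convergence in `GL_n(F)` (`tendsto_units_of_tendsto_val`) and in every subgroup `Γ` containing the conjugators (`mem_closure_conj_subgroup`).  Dealt by K2E3-plan (g1) 2026-09-03T23:09:36Z (c)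
to K2E5-p11 (g2) (file 1 ★ p855578; file 1b = this; file 2 = the unitary descent, NOT here).  PROOF lane, THEOREMS ONLY; Mathlib + ★ file 1; `--supports stmt-HodgeConjecture-24833 --as helper`.
[HarishChandra1999, §21 p. 87]: «Let 𝒪 be a G-orbit in G. Then the closure of 𝒪 contains a semisimple element γ.»
HONEST LABEL: HC_CM is proved only modulo the 7 printed citations (2 remaining named inputs: hLiu418 = stmt-HodgeConjecture-24832, h413 = stmt-HodgeConjecture-24833) until rung 0
closes; count-neutral helper.

## References
* [HarishChandra1999] Harish-Chandra (notes by S. DeBacker, P. J. Sally), *Admissible Invariant Distributions on Reductive p-adic Groups*, ULS 16 (1999), §21 p. 87.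
* [Borel1991] A. Borel, *Linear Algebraic Groups*, 2nd ed., GTM 126 (1991), §4.4, §11.8.
-/

set_option autoImplicit false
-- the mandated namespace repeats the single-problem summit's segment (`HodgeConjecture.HodgeConjecture`)
set_option linter.dupNamespace false

noncomputable section

namespace Summit.HodgeConjecture.HodgeConjecture.Cruxes.H413.K2E3OrbitClosureSemisimpleEngineGL

open Filter Topology Matrix
open Summit.HodgeConjecture.HodgeConjecture.Cruxes.H413.K2E3OrbitClosureSemisimpleEngine

variable {F : Type*} [Field F] [TopologicalSpace F] [IsTopologicalRing F] [ContinuousInv₀ F] {n : Type*} [Fintype n] [DecidableEq n]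

/-- **Inverses converge** (continuous inversion on `F`): if invertible matrices `c k → s` with `det s ≠ 0` then `(c k)⁻¹ → s⁻¹` (`A⁻¹ = (det A)⁻¹ · adj A`, `det` and `adj` polynomial).
[cite: Borel1991, §4.4] -/
theorem tendsto_matrix_inv {c : ℕ → Matrix n n F} {s : Matrix n n F} (hs : s.det ≠ 0) (h : Tendsto c atTop (𝓝 s)) :
    Tendsto (fun k => (c k)⁻¹) atTop (𝓝 s⁻¹) := by
  have hdet : Tendsto (fun k => (c k).det) atTop (𝓝 s.det) := ((continuous_id.matrix_det).tendsto s).comp h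
  have hadj : Tendsto (fun k => (c k).adjugate) atTop (𝓝 s.adjugate) := ((continuous_id.matrix_adjugate).tendsto s).comp h
  have e : (fun k => (c k)⁻¹) = fun k => ((c k).det)⁻¹ • (c k).adjugate := funext fun k => by rw [Matrix.inv_def, Ring.inverse_eq_inv']
  rw [e, Matrix.inv_def, Ring.inverse_eq_inv']
  exact (hdet.inv₀ hs).smul hadj

/-- **Convergence in `GL_n(F)` from convergence of the underlying matrices** (units topology = values and inverses). [cite: Borel1991, §4.4] -/
theorem tendsto_units_of_tendsto_val {c : ℕ → GL n F} {s : GL n F} (h : Tendsto (fun k => (c k : Matrix n n F)) atTop (𝓝 (s : Matrix n n F))) :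
    Tendsto c atTop (𝓝 s) := by
  rw [Units.isInducing_embedProduct.tendsto_nhds_iff]
  refine h.prodMk_nhds ?_
  have hi : Tendsto (fun k => (((c k)⁻¹ : GL n F) : Matrix n n F)) atTop (𝓝 (((s⁻¹ : GL n F)) : Matrix n n F)) := by
    simp only [Matrix.coe_units_inv]
    exact tendsto_matrix_inv (Matrix.isUnits_det_units s).ne_zero h
  exact (MulOpposite.continuous_op.tendsto _).comp hi

omit [IsTopologicalRing F] [ContinuousInv₀ F] in
/-- **A limit of `Γ`-conjugates, read inside the subgroup `Γ`** (subspace topology): if `γ k · x · (γ k)⁻¹ → s` in `GL_n(F)` with `γ k, x, s ∈ Γ`, then `s` lies in the closure IN `Γ` of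
the `Γ`-conjugacy class of `x` — the shape of socket U12-b (`Γ = U_N(H)(L⁺_v)`). [cite: HarishChandra1999, §21 p. 87] -/
theorem mem_closure_conj_subgroup {Γ : Subgroup (GL n F)} {x s : Γ} {γ : ℕ → Γ}
    (h : Tendsto (fun k => ((γ k : GL n F) * x * ((γ k : GL n F))⁻¹)) atTop (𝓝 (s : GL n F))) :
    s ∈ closure (Set.range fun g : Γ => g * x * g⁻¹) := by
  have h' : Tendsto (fun k => γ k * x * (γ k)⁻¹) atTop (𝓝 s) := by
    rw [tendsto_subtype_rng]
    simpa only [Subgroup.coe_mul, Subgroup.coe_inv] using h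
  exact mem_closure_of_tendsto h' (Eventually.of_forall fun k => ⟨γ k, rfl⟩)

/-- **HC1999 §21 FOR `GL_n(F)` IN ITS OWN TOPOLOGY**: `F` a topological field with continuous inversion and an element `u ≠ 0`, `uᵏ → 0`; `s, x ∈ GL_n(F)` with `s` semisimple
(`Module.End.IsSemisimple (toLin' s)`), `x − s` nilpotent and `sx = xs` (Jordan form `x = s·u_x`).  Then the cocharacter of ★ file 1 conjugates `x` to `s` IN `GL_n(F)`:
`∃ Λ : Fˣ →* GL n F, (∀ t, Λ t * s * (Λ t)⁻¹ = s) ∧ Λ(uᵏ) x Λ(uᵏ)⁻¹ → s`. [cite: HarishChandra1999, §21 p. 87] [cite: Borel1991, §4.4, §11.8] -/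
theorem exists_cocharacter_conj_tendsto_GL (u : Fˣ) (hu : Tendsto (fun k : ℕ => (u : F) ^ k) atTop (𝓝 0)) {s x : GL n F}
    (hs : Module.End.IsSemisimple (Matrix.toLin' (s : Matrix n n F))) (hN : IsNilpotent ((x : Matrix n n F) - s)) (hc : (s : Matrix n n F) * x = x * s) :
    ∃ Λ : Fˣ →* GL n F, (∀ t, Λ t * s * (Λ t)⁻¹ = s) ∧ Tendsto (fun k : ℕ => Λ (u ^ k) * x * (Λ (u ^ k))⁻¹) atTop (𝓝 s) := by
  have hc' : (s : Matrix n n F) * ((x : Matrix n n F) - s) = ((x : Matrix n n F) - s) * s := by rw [Matrix.mul_sub, Matrix.sub_mul, hc]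
  obtain ⟨Λ, hfix, hT⟩ := exists_cocharacter_conj_tendsto u hu hs hN hc'
  rw [add_sub_cancel] at hT
  refine ⟨Λ, fun t => Units.ext ?_, tendsto_units_of_tendsto_val ?_⟩
  · rw [Units.val_mul, Units.val_mul]
    exact hfix t
  · simp only [Units.val_mul]
    exact hT

/-- **COROLLARY (closure in `GL_n(F)`)**: under the same hypotheses `s ∈ closure {g x g⁻¹ : g ∈ GL_n(F)}`, closure in the topological group `GL_n(F)`.
[cite: HarishChandra1999, §21 p. 87] -/
theorem semisimplePart_mem_closure_conjClass_GL (u : Fˣ) (hu : Tendsto (fun k : ℕ => (u : F) ^ k) atTop (𝓝 0)) {s x : GL n F}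
    (hs : Module.End.IsSemisimple (Matrix.toLin' (s : Matrix n n F))) (hN : IsNilpotent ((x : Matrix n n F) - s)) (hc : (s : Matrix n n F) * x = x * s) :
    s ∈ closure (Set.range fun g : GL n F => g * x * g⁻¹) := by
  obtain ⟨Λ, -, hT⟩ := exists_cocharacter_conj_tendsto_GL u hu hs hN hc
  exact mem_closure_of_tendsto hT (Eventually.of_forall fun k => ⟨Λ (u ^ k), rfl⟩)

/-- **COROLLARY (inside a subgroup `Γ`)**: if moreover `s, x ∈ Γ` and the cocharacter values `Λ(uᵏ)` lie in `Γ` for SOME cocharacter as in ★ file 1 — here packaged as: for every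
sequence `γ k ∈ Γ` with `γ k · x · (γ k)⁻¹ → s` in `GL_n(F)` — then `s` is in the closure in `Γ` of the `Γ`-class of `x`; with `Γ = U_N(H)(L⁺_v)` this is row 10 once file 2
produces the conjugating sequence inside `Γ`. [cite: HarishChandra1999, §21 p. 87] -/
theorem semisimplePart_mem_closure_conjClass_subgroup {Γ : Subgroup (GL n F)} {s x : Γ} (γ : ℕ → Γ)
    (h : Tendsto (fun k => ((γ k : GL n F) : Matrix n n F) * ((x : GL n F) : Matrix n n F) * (((γ k : GL n F)⁻¹ : GL n F) : Matrix n n F)) atTop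
      (𝓝 ((s : GL n F) : Matrix n n F))) :
    s ∈ closure (Set.range fun g : Γ => g * x * g⁻¹) := by
  refine mem_closure_conj_subgroup (γ := γ) (tendsto_units_of_tendsto_val ?_)
  simp only [Units.val_mul]
  exact h

end Summit.HodgeConjecture.HodgeConjecture.Cruxes.H413.K2E3OrbitClosureSemisimpleEngineGL

end
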